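import Literature.Geometry.Riemannian.RicciFlow
import Literature.Geometry.Lorentzian.LeviCivitaProofs
import HarnessLib

/-!
# The DeTurck vector field and the Ricci–DeTurck flow
(topic `Geometry/Riemannian`)

Definitions for the second layer of the decomposition of the named fact
`Literature.Geometry.Riemannian.ricciFlow_uniqueness` (`RicciFlow.lean`; Hamilton 1982,
Thm. 5.1; Topping 2006, Thm. 5.2.2) along DeTurck's route (DeTurck 1983; Andrews–Hopper 2011,
§5.4; Topping 2006, §5.2; Hamilton 1995, §6); the reduction theorem itself (Andrews–Hopper 2011,
§5.4.2, proof of Thm. 5.2, Step 6) is `RicciDeTurckReduction.lean`. Everything here is a real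
definition or a proved lemma; no named fact is introduced.

* `traceVec g x B` — the metric trace `g^{pq} B(e_p, e_q) ∈ T_x M` of a vector-valued bilinear
  map `B` on `T_x M` (via `g.sharp`, `g.trace` of `PseudoRiemannianMetric.lean`; defining property
  `val_traceVec`; O'Neill 1983, Ch. 3, pp. 60–61, metric contraction).
* `deTurckField g cov bg` — the **DeTurck vector field** `W^k = g^{pq} (Γ^k_{pq} - Γ̃^k_{pq})` of
  `g` (with connection `cov = ∇`) relative to a background connection `bg = ∇̃`
  (Andrews–Hopper 2011, (5.7)): the metric trace of Mathlib's difference tensor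
  `CovariantDerivative.difference cov bg` of the two connections. For a Levi-Civita `cov` it
  depends on `cov` only through `g` (`deTurckField_eq_of_isLeviCivita`, by uniqueness of the
  Levi-Civita connection on differentiable sections, `IsLeviCivita.eq_leviCivita_holds` of
  `LeviCivitaProofs.lean`).
* `lieDerivMetric g cov W x X Y = g(∇_X W, Y) + g(X, ∇_Y W)` — the Lie derivative `ℒ_W g`
  expressed through the (Levi-Civita) connection (index form `∇_i W_j + ∇_j W_i`).
* `IsRicciDeTurckFlow g cov bg S` — the **Ricci–DeTurck flow**
  `∂g/∂t = -2 Ric(g) + ℒ_W g`, `W = deTurckField (g t) (cov t) bg` (Andrews–Hopper 2011, (5.10);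
  Topping 2006, (5.2.1) with `T = ḡ(0)`), in the format of `IsRicciFlow` (`RicciFlow.lean`):
  jointly smooth family, Levi-Civita witnesses, pointwise equation as a derivative within the
  time set; `IsRicciDeTurckFlow.mono`.

## References

* B. Andrews, C. Hopper, *The Ricci flow in Riemannian geometry*, LNM 2011 (2011), §5.4.1,
  (5.7); §5.4.2, (5.10). [AndrewsHopper2011]
* D. M. DeTurck, *Deforming metrics in the direction of their Ricci tensors*, J. Differential
  Geom. 18 (1983) 157–162. [DeTurck1983]
* P. Topping, *Lectures on the Ricci flow*, LMS LNS 325 (2006), §5.2, (5.2.1); (2.3.8).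
  [Topping2006]
* B. O'Neill, *Semi-Riemannian geometry*, Academic Press 1983, Ch. 3, Thm. 3.11, pp. 60–61.
  [ONeill1983]
-/

noncomputable section

open Bundle Set Filter FiberBundle
open scoped Manifold ContDiff Topology

namespace Literature.Geometry.Riemannian

open Lorentzian Lorentzian.PseudoRiemannianMetric

variable {E : Type*} [NormedAddCommGroup E] [NormedSpace ℝ E] {H : Type*} [TopologicalSpace H]
  {I : ModelWithCorners ℝ E H} {M : Type*} [TopologicalSpace M] [ChartedSpace H M]
  [IsManifold I ∞ M] {n : ℕ∞ω} [FiniteDimensional ℝ E]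

/-! ### The metric trace of a vector-valued bilinear map; the DeTurck vector field -/

section TraceVec

variable (g : PseudoRiemannianMetric I n E (TangentSpace I : M → Type _)) (x : M)

/-- The bilinear form `(X, Y) ↦ g_x(B(X, Y), Z)` attached to a vector-valued bilinear map `B` on
`T_x M` and a vector `Z` (an auxiliary for `traceVec`). [folklore] -/
def bilinFormOfVec (B : TangentSpace I x →L[ℝ] TangentSpace I x →L[ℝ] TangentSpace I x)
    (Z : TangentSpace I x) : LinearMap.BilinForm ℝ (TangentSpace I x) :=
  LinearMap.mk₂ ℝ (fun X Y ↦ g.val x (B X Y) Z)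
    (fun X X' Y ↦ by simp) (fun c X Y ↦ by simp) (fun X Y Y' ↦ by simp) (fun c X Y ↦ by simp)

omit [FiniteDimensional ℝ E] in
/-- Unfolding lemma for `bilinFormOfVec`. [folklore] -/
@[simp]
lemma bilinFormOfVec_apply (B : TangentSpace I x →L[ℝ] TangentSpace I x →L[ℝ] TangentSpace I x)
    (Z X Y : TangentSpace I x) : bilinFormOfVec g x B Z X Y = g.val x (B X Y) Z := rfl

omit [FiniteDimensional ℝ E] in
/-- `bilinFormOfVec` is additive in the vector `Z`. [folklore] -/
lemma bilinFormOfVec_add (B : TangentSpace I x →L[ℝ] TangentSpace I x →L[ℝ] TangentSpace I x)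
    (Z Z' : TangentSpace I x) :
    bilinFormOfVec g x B (Z + Z') = bilinFormOfVec g x B Z + bilinFormOfVec g x B Z' :=
  LinearMap.ext₂ fun X Y ↦ by simp

omit [FiniteDimensional ℝ E] in
/-- `bilinFormOfVec` is homogeneous in the vector `Z`. [folklore] -/
lemma bilinFormOfVec_smul (B : TangentSpace I x →L[ℝ] TangentSpace I x →L[ℝ] TangentSpace I x)
    (c : ℝ) (Z : TangentSpace I x) :
    bilinFormOfVec g x B (c • Z) = c • bilinFormOfVec g x B Z :=
  LinearMap.ext₂ fun X Y ↦ by simp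

/-- The covector `Z ↦ tr_g ((X, Y) ↦ g_x(B(X, Y), Z)) = g^{pq} g_x(B(e_p, e_q), Z)` whose metric
dual is the metric trace `g^{pq} B(e_p, e_q)` of `B` (O'Neill 1983, Ch. 3, pp. 60–61, metric
contraction). [folklore] -/
def traceVecDual (B : TangentSpace I x →L[ℝ] TangentSpace I x →L[ℝ] TangentSpace I x) :
    Module.Dual ℝ (TangentSpace I x) where
  toFun Z := g.trace x (bilinFormOfVec g x B Z)
  map_add' Z Z' := by
    simp only [PseudoRiemannianMetric.trace, bilinFormOfVec_add, LinearMap.comp_add, map_add]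
  map_smul' c Z := by
    simp only [PseudoRiemannianMetric.trace, bilinFormOfVec_smul, LinearMap.comp_smul, map_smul,
      RingHom.id_apply, smul_eq_mul]

/-- Unfolding lemma for `traceVecDual`. [folklore] -/
@[simp]
lemma traceVecDual_apply (B : TangentSpace I x →L[ℝ] TangentSpace I x →L[ℝ] TangentSpace I x)
    (Z : TangentSpace I x) : traceVecDual g x B Z = g.trace x (bilinFormOfVec g x B Z) := rfl

/-- The **metric trace** `tr_g B = g^{pq} B(e_p, e_q) ∈ T_x M` of a vector-valued bilinear map
`B` on `T_x M`: the vector `W` with `g_x(W, Z) = tr_g ((X, Y) ↦ g_x(B(X, Y), Z))` for all `Z`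
(index raising `g.sharp` of `traceVecDual`; `val_traceVec`). O'Neill 1983, Ch. 3, pp. 60–61
(metric contraction). [folklore] -/
def traceVec (B : TangentSpace I x →L[ℝ] TangentSpace I x →L[ℝ] TangentSpace I x) :
    TangentSpace I x :=
  g.sharp x (traceVecDual g x B)

/-- Defining property of the metric trace of a vector-valued bilinear map:
`g_x(tr_g B, Z) = tr_g ((X, Y) ↦ g_x(B(X, Y), Z))`. [folklore] -/
@[simp]
lemma val_traceVec (B : TangentSpace I x →L[ℝ] TangentSpace I x →L[ℝ] TangentSpace I x)
    (Z : TangentSpace I x) :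
    g.val x (traceVec g x B) Z = g.trace x (bilinFormOfVec g x B Z) := by
  simp [traceVec]

end TraceVec

section DeTurck

variable [CompleteSpace E] (g : PseudoRiemannianMetric I ∞ E (TangentSpace I : M → Type _))
  (cov bg : CovariantDerivative I E (TangentSpace I : M → Type _))

/-- The **DeTurck vector field** of the metric `g` with connection `cov = ∇` relative to the
background connection `bg = ∇̃`: `W^k = g^{pq} (Γ^k_{pq} - Γ̃^k_{pq})` (Andrews–Hopper 2011,
(5.7); DeTurck 1983), i.e. the metric trace (`traceVec`) of the difference tensor
`A = ∇ - ∇̃` of the two connections — Mathlib's `CovariantDerivative.difference cov bg x`, the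
continuous bilinear map with `A(Y₀)(X₀) = ∇_{X₀} Y - ∇̃_{X₀} Y` for any section `Y` through `Y₀`
differentiable at `x` (`difference_apply`; the trace is over both slots, and `g^{pq}` is
symmetric, so the order of the slots is immaterial). "As it is the difference of two connections,
it is a globally well defined vector field" (loc. cit.). For `cov` a Levi-Civita connection of `g`
it depends on `cov` only through `g` (`deTurckField_eq_of_isLeviCivita`).
[cite: AndrewsHopper2011, §5.4.1, (5.7)] -/
def deTurckField (x : M) : TangentSpace I x :=
  traceVec g x (cov.difference bg x)

/-- The **Lie derivative of the metric along `W`, through the connection**: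
`(ℒ_W g)(X, Y) = g(∇_X W, Y) + g(X, ∇_Y W)` at `x` (valid for the Levi-Civita connection `∇` of
`g`: torsion-free and compatible; in index form `∇_i W_j + ∇_j W_i`, Andrews–Hopper 2011, (5.10);
Topping 2006, (2.3.8): `ℒ_{ω♯} g(X, W) = ∇ω(X, W) + ∇ω(W, X)`). Recall Mathlib's argument order
`cov W x X = ∇_X W`. [cite: AndrewsHopper2011, §5.4.2, (5.10)] -/
def lieDerivMetric (W : Π x : M, TangentSpace I x) (x : M) (X Y : TangentSpace I x) : ℝ :=
  g.val x (cov W x X) Y + g.val x X (cov W x Y)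

variable {g cov bg}

/-- The difference tensor with a fixed background of two Levi-Civita connections of the same
metric is the same: it is evaluated on (extended, hence differentiable) sections, on which
torsion-free compatible connections agree (uniqueness half of the fundamental lemma,
`IsLeviCivita.eq_leviCivita_holds`, O'Neill 1983, Thm. 3.11). [cite: ONeill1983, Ch. 3, Thm. 3.11] -/
theorem difference_eq_of_isLeviCivita {cov' : CovariantDerivative I E (TangentSpace I : M → Type _)}
    (h : g.IsLeviCivita cov) (h' : g.IsLeviCivita cov') (x : M) :
    cov.difference bg x = cov'.difference bg x := by
  haveI := g.hasLeviCivita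
  ext Y₀ X₀
  have hY : MDiffAt (T% (extend E Y₀)) x := mdifferentiableAt_extend I E Y₀
  have h₁ := IsCovariantDerivativeOn.difference_apply (x := x) cov.isCovariantDerivativeOnUniv
    bg.isCovariantDerivativeOnUniv (σ := extend E Y₀) (by trivial) hY
  have h₂ := IsCovariantDerivativeOn.difference_apply (x := x) cov'.isCovariantDerivativeOnUniv
    bg.isCovariantDerivativeOnUniv (σ := extend E Y₀) (by trivial) hY
  simp only [extend_apply_self] at h₁ h₂
  change (cov.isCovariantDerivativeOnUniv.difference bg.isCovariantDerivativeOnUniv x) Y₀ X₀ =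
    (cov'.isCovariantDerivativeOnUniv.difference bg.isCovariantDerivativeOnUniv x) Y₀ X₀
  rw [h₁, h₂, IsLeviCivita.eq_leviCivita_holds (g := g) h hY,
    IsLeviCivita.eq_leviCivita_holds (g := g) h' hY]

/-- **The DeTurck field of a metric does not depend on the choice of its Levi-Civita witness**:
two torsion-free `g`-compatible connections have the same DeTurck field relative to any
background (they have the same difference tensor with it, `difference_eq_of_isLeviCivita`).
[folklore] -/
theorem deTurckField_eq_of_isLeviCivita
    {cov' : CovariantDerivative I E (TangentSpace I : M → Type _)}
    (h : g.IsLeviCivita cov) (h' : g.IsLeviCivita cov') :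
    deTurckField g cov bg = deTurckField g cov' bg := by
  funext x
  simp only [deTurckField, difference_eq_of_isLeviCivita (bg := bg) h h' x]

end DeTurck

/-! ### The Ricci–DeTurck flow -/

section RicciDeTurckFlow

variable [CompleteSpace E]

/-- **Ricci–DeTurck flow** relative to the background connection `bg = ∇̃` (Andrews–Hopper 2011,
(5.10): `∂g_ij/∂t = -2R_ij + ∇_i W_j + ∇_j W_i`, `W^k = g^{pq}(Γ^k_{pq} - Γ̃^k_{pq})`;
DeTurck 1983; Topping 2006, (5.2.1) with `T = ḡ(0)`), in the format of `IsRicciFlow`: the pair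
`(g, cov)` of a one-parameter family of `C^∞` metrics and of covariant derivatives is a
Ricci–DeTurck flow on the time set `S` if the family is smooth on `M × S`, each `cov t` is a
Levi-Civita connection of `g t`, and for all `t ∈ S`, `x`, `X, Y ∈ T_x M`,
`d/ds|_{s=t} g_s(x)(X, Y) = -2 Ric_{g_t}(x)(X, Y) + (ℒ_{W_t} g_t)(x)(X, Y)` within `S`, where
`W_t = deTurckField (g t) (cov t) bg` and `ℒ_W g (X, Y) = g(∇_X W, Y) + g(X, ∇_Y W)`
(`lieDerivMetric`). [cite: AndrewsHopper2011, §5.4.2, (5.10)] [cite: DeTurck1983] -/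
structure IsRicciDeTurckFlow (g : ℝ → PseudoRiemannianMetric I ∞ E (TangentSpace I : M → Type _))
    (cov : ℝ → CovariantDerivative I E (TangentSpace I : M → Type _))
    (bg : CovariantDerivative I E (TangentSpace I : M → Type _)) (S : Set ℝ) : Prop where
  /-- The family is smooth jointly in space and time on `M × S`. -/
  smooth : IsContMDiffFamilyOn ∞ g S
  /-- `cov t` is a Levi-Civita connection of `g t`. -/
  isLeviCivita : ∀ t ∈ S, (g t).IsLeviCivita (cov t)
  /-- The Ricci–DeTurck equation `∂/∂t g_t(x)(X,Y) = -2 Ric_{g_t}(x)(X,Y) + (ℒ_{W_t} g_t)(x)(X,Y)`. -/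
  hasDerivWithinAt : ∀ t ∈ S, ∀ (x : M) (X Y : TangentSpace I x),
    HasDerivWithinAt (fun s : ℝ ↦ (g s).val x X Y)
      (-2 * (cov t).ricci x X Y +
        lieDerivMetric (g t) (cov t) (deTurckField (g t) (cov t) bg) x X Y) S t

variable {g : ℝ → PseudoRiemannianMetric I ∞ E (TangentSpace I : M → Type _)}
  {cov : ℝ → CovariantDerivative I E (TangentSpace I : M → Type _)}
  {bg : CovariantDerivative I E (TangentSpace I : M → Type _)} {S S' : Set ℝ}

/-- A Ricci–DeTurck flow on `S` restricts to one on every `S' ⊆ S`. [folklore] -/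
theorem IsRicciDeTurckFlow.mono (h : IsRicciDeTurckFlow g cov bg S) (hS : S' ⊆ S) :
    IsRicciDeTurckFlow g cov bg S' where
  smooth := h.smooth.mono hS
  isLeviCivita t ht := h.isLeviCivita t (hS ht)
  hasDerivWithinAt t ht x X Y := (h.hasDerivWithinAt t (hS ht) x X Y).mono hS

end RicciDeTurckFlow

end Literature.Geometry.Riemannian

end
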